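import Summits.AtomisticToContinuum.Crystallization.Theorems.PricedLinkCensusChargedPeriodicIsOptimalDecomp
import Summits.AtomisticToContinuum.Crystallization.Theorems.ChargedEnergyGap.Negative.Unconditional

/-!
# `ChargedPeriodicIsOptimal` (stmt-AtomisticToContinuum-2913): proof

Item stmt-AtomisticToContinuum-2913 of route `PricedLinkCensus` (shared support item of eight
`Crystallization` routes): **a periodic configuration `Q` of `ℝ³` that is charged with
positive density at every scale by a sequence of Lennard-Jones ground states has the least
energy per particle among all periodic configurations.**

Proof (excision only — no insertion is needed).  Let `E(N)/N → e_∞` (thermodynamic limit,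
`BlancLewin2015_8_holds`; by the tree's `crysEnergyLimit`, `e_∞ = ⨅_Q' e(Q')`).  We show
`e(Q) ≤ e_∞` (`energyPerParticle_le_of_charged`); since `e_∞ ≤ e(Q')` for every periodic `Q'`
(trial states, tree `eStar_le`), `e(Q)` is the least value.
Fix `η > 0`.  Choose a block size `K` with small sixth-power tails (`exists_sum_tailSix_le`),
so that the block `F + [0,K)³·b` of `n = #F K³` points has energy `≥ n(e(Q) − η/8)` up to the
near cross terms of a matched copy; a matching tolerance `ε` from the continuity modulus of the
finite energy at the block; a margin `T` killing the far `r⁻⁶` cross terms; `R = R₀ + ε + T`.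
The charging hypothesis gives `ρ > 0` and infinitely many `N` with `≥ ρN` good particles; a
maximal `2R`-separated sub-family of them has `≥ ρN/(4R/δ + 1)³` members (packing, `δ` the
minimal distance in ground states), of which we keep `k = ⌊cN⌋`.  The excision estimate
(`surgery_estimate`) gives `E(N) − E(N − kn) ≥ kn(e(Q) − 3η/8)`, while `E(M) = M(e_∞ ± η₃)` at
`M = N` and `M = N − kn ≥ 7N/8` gives `E(N) − E(N − kn) ≤ kn·e_∞ + 2η₃N ≤ kn(e_∞ + η/2)` —
hence `e(Q) ≤ e_∞ + η`.

Main results: `surgery_estimate` (the excision estimate at fixed `N`),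
`energyPerParticle_le_of_charged`, and the item
`Summit.AtomisticToContinuum.Crystallization.Theorems.chargedPeriodicIsOptimal_proof`.
All `[folklore]` (the surgery argument of the item's sketch; Blanc–Lewin 2015, §1.3 and §2.1,
for the thermodynamic limit and the trial states, both already in the tree).
-/

noncomputable section

namespace Summit.AtomisticToContinuum.Crystallization.Theorems.ChargedPeriodicOptimal

open Literature.MathematicalPhysics.StatisticalMechanics
open Summit.AtomisticToContinuum.Crystallization.Theorems.ChargedEnergyGapNegative
open Summit.AtomisticToContinuum.Crystallization.Theorems.ChargedEnergyGapNegative.Blocks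
open scoped BigOperators
open Metric Filter Topology

/-! ## The excision estimate at fixed particle number -/

/-- **The excision estimate.** See the module docstring: `k = #T'` disjoint patches of
`n = #(BIdx Q K)` particles, each an `ε`-perturbation of a rigid image of the block of `Q`,
are removed from the ground state `y`; the remaining `N − kn` particles cost at least
`E(N − kn)`, each patch has energy within `η'` of `E(block)`, and the cross terms of a patch
are at least `−(1/6)(64 Σ_u tailSix u + n · 250 δL⁻⁵ T⁻¹)`. [folklore] -/
theorem surgery_estimate (Q : PeriodicConfiguration 3) (K : ℕ) {N : ℕ} {y : Fin N → E3}
    (hy : Function.Injective y)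
    {δL : ℝ} (hδL : 0 < δL) (hsepL : ∀ k l, k ≠ l → δL ≤ dist (y k) (y l))
    {δQ : ℝ} (hδQ : 0 < δQ) (hsepQ : ∀ s ∈ Q.points, ∀ s' ∈ Q.points, s ≠ s' → δQ ≤ dist s s')
    {R₀ : ℝ} (hR₀ : ∀ u : BIdx Q K, ∀ y' ∈ Q.motif, dist (bpt Q K u) y' ≤ R₀)
    {η' ε₀ : ℝ} (hmod : ∀ z : BIdx Q K → E3, (∀ u, dist (z u) (bpt Q K u) ≤ ε₀) →
      |interactionEnergy lennardJones (z ∘ (Fintype.equivFin (BIdx Q K)).symm) -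
          interactionEnergy lennardJones (blockConfig Q K)| ≤ η')
    {ε : ℝ} (hε0 : 0 < ε) (hεε₀ : ε ≤ ε₀) (hεQ : 4 * ε ≤ δQ) (hεL : 2 * ε < δL)
    {T R : ℝ} (hT : 0 < T) (hR : R₀ + ε + T ≤ R)
    (T' : Finset (Fin N))
    (hgood : ∀ t ∈ T', ∃ A : E3 →ₗᵢ[ℝ] E3, ∃ q ∈ Q.points,
      (∀ s ∈ Q.points, dist s q ≤ R → ∃ j : Fin N, dist (y j) (y t + A (s - q)) ≤ ε) ∧
      (∀ j : Fin N, dist (y j) (y t) ≤ R → ∃ s ∈ Q.points, dist (y j) (y t + A (s - q)) ≤ ε))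
    (hsepT : ∀ t ∈ T', ∀ t' ∈ T', t ≠ t' → 2 * R < dist (y t) (y t')) :
    T'.card * Fintype.card (BIdx Q K) ≤ N ∧
    groundStateEnergy lennardJones 3 (N - T'.card * Fintype.card (BIdx Q K)) +
        T'.card * (interactionEnergy lennardJones (blockConfig Q K) - η') -
        1 / 6 * T'.card * (64 * ∑ u : BIdx Q K, tailSix Q K u +
          Fintype.card (BIdx Q K) * (250 * δL⁻¹ ^ 5 * T⁻¹)) ≤
      interactionEnergy lennardJones y := by
  classical
  -- the matching data of the good particles
  have hdata := fun t : T' => hgood t.1 t.2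
  choose A q hq hA hB using hdata
  have hq' : ∀ t : T', ∃ y' ∈ Q.motif, ∃ g ∈ Q.lattice, q t = y' + g := fun t => hq t
  choose y' hy' g hg hqe using hq'
  have hRR₀ : R₀ + ε ≤ R := by linarith
  -- the patch maps: block points translated by `g t` are points of `Q` within `R` of `q t`
  have hex : ∀ (t : T') (u : BIdx Q K), ∃ j : Fin N,
      dist (y j) (y t + A t (bpt Q K u + g t - (y' t + g t))) ≤ ε := by
    intro t u
    have hmem : bpt Q K u + g t ∈ Q.points := Q.add_mem_points (bpt_mem Q K u) (hg t)
    have hdist : dist (bpt Q K u + g t) (q t) ≤ R := by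
      rw [hqe t, dist_add_right]
      exact (hR₀ u (y' t) (hy' t)).trans (by linarith)
    obtain ⟨j, hj⟩ := hA t _ hmem hdist
    exact ⟨j, by rw [← hqe t]; exact hj⟩
  choose φ hφ using hex
  have hB' : ∀ (t : T') (j : Fin N), dist (y j) (y t) ≤ R →
      ∃ s ∈ Q.points, dist (y j) (y t + A t (s - (y' t + g t))) ≤ ε := by
    intro t j hj
    rw [← hqe t]
    exact hB t j hj
  -- properties of the patches
  have hR₀' : ∀ t : T', ∀ u, dist (bpt Q K u) (y' t) ≤ R₀ := fun t u => hR₀ u _ (hy' t)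
  have hinj : ∀ t : T', Function.Injective (φ t) := fun t =>
    patch_injective Q K hsepQ (by linarith) (hφ t)
  have hcen : ∀ (t : T') (u : BIdx Q K), dist (y (φ t u)) (y t) ≤ R₀ + ε := fun t u =>
    dist_patch_center_le Q K (hR₀' t) (hφ t) u
  -- the patches as finsets
  set P : Fin N → Finset (Fin N) := fun i =>
    if h : i ∈ T' then Finset.univ.image (φ ⟨i, h⟩) else ∅ with hP_def
  have hP : ∀ t : T', P t = Finset.univ.image (φ t) := by
    intro t
    simp only [hP_def, dif_pos t.2]
  have hPcard : ∀ t : T', (P t).card = Fintype.card (BIdx Q K) := by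
    intro t
    rw [hP t, Finset.card_image_of_injective _ (hinj t), Finset.card_univ]
  have hdisj : (T' : Set (Fin N)).PairwiseDisjoint P := by
    intro t ht t' ht' hne
    rw [Function.onFun, Finset.disjoint_left]
    intro a ha ha'
    rw [hP ⟨t, ht⟩] at ha
    rw [hP ⟨t', ht'⟩] at ha'
    obtain ⟨u, -, rfl⟩ := Finset.mem_image.1 ha
    obtain ⟨u', -, hu'⟩ := Finset.mem_image.1 ha'
    have h1 := hcen ⟨t, ht⟩ u
    have h2 := hcen ⟨t', ht'⟩ u'
    rw [hu'] at h2
    have h3 := hsepT t ht t' ht' hne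
    have h4 := dist_triangle_left (y t) (y t') (y (φ ⟨t, ht⟩ u))
    exact absurd h3 (not_lt.2 (by linarith))
  -- cardinalities
  have hScard : (T'.biUnion P).card = T'.card * Fintype.card (BIdx Q K) := by
    rw [Finset.card_biUnion hdisj, Finset.sum_const_nat fun t ht => hPcard ⟨t, ht⟩]
  have hle : T'.card * Fintype.card (BIdx Q K) ≤ N := by
    have := Finset.card_le_univ (T'.biUnion P)
    rwa [hScard, Fintype.card_fin] at this
  have hcompl : (T'.biUnion P)ᶜ.card = N - T'.card * Fintype.card (BIdx Q K) := by
    rw [Finset.card_compl, hScard, Fintype.card_fin]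
  refine ⟨hle, ?_⟩
  -- the excision inequality
  have hexc := two_mul_energy_ge_excision hy T' P hdisj
  rw [hcompl] at hexc
  -- patch energies are close to the block energy
  have hpatchE : ∀ t ∈ T', 2 * (interactionEnergy lennardJones (blockConfig Q K) - η') ≤
      ∑ a ∈ P t, ∑ b ∈ P t, lennardJones (dist (y a) (y b)) := by
    intro t ht
    rw [hP ⟨t, ht⟩, sum_sum_image_eq_two_mul_energy Q K y (hinj ⟨t, ht⟩)]
    have h := abs_energy_sub_le_of_near_image Q K hmod (A ⟨t, ht⟩) (y t) (g ⟨t, ht⟩)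
      (y' ⟨t, ht⟩ + g ⟨t, ht⟩) (y ∘ φ ⟨t, ht⟩) (fun u => (hφ ⟨t, ht⟩ u).trans hεε₀)
    rw [abs_le] at h
    linarith [h.1]
  have hsumE : (T'.card : ℝ) * (2 * (interactionEnergy lennardJones (blockConfig Q K) - η')) ≤
      ∑ t ∈ T', ∑ a ∈ P t, ∑ b ∈ P t, lennardJones (dist (y a) (y b)) := by
    have := Finset.sum_le_sum hpatchE
    rwa [Finset.sum_const, nsmul_eq_mul] at this
  -- cross terms of the patches
  have hcross : ∀ t ∈ T', ∑ a ∈ P t, ∑ b ∈ (P t)ᶜ, (dist (y a) (y b))⁻¹ ^ 6 ≤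
      64 * ∑ u : BIdx Q K, tailSix Q K u +
        Fintype.card (BIdx Q K) * (250 * δL⁻¹ ^ 5 * T⁻¹) := by
    intro t ht
    rw [hP ⟨t, ht⟩, Finset.sum_image (fun a _ b _ h => hinj ⟨t, ht⟩ h)]
    exact patch_cross_le Q K hδL hsepL hδQ hsepQ hεQ hεL (hg ⟨t, ht⟩) hT hR (hR₀' ⟨t, ht⟩)
      (hφ ⟨t, ht⟩) (hB' ⟨t, ht⟩)
  have hsumC : ∑ t ∈ T', ∑ a ∈ P t, ∑ b ∈ (P t)ᶜ, (dist (y a) (y b))⁻¹ ^ 6 ≤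
      T'.card * (64 * ∑ u : BIdx Q K, tailSix Q K u +
        Fintype.card (BIdx Q K) * (250 * δL⁻¹ ^ 5 * T⁻¹)) := by
    have := Finset.sum_le_sum hcross
    rwa [Finset.sum_const, nsmul_eq_mul] at this
  linarith [hexc, hsumE, hsumC, hε0]


/-! ## The main estimate -/

/-- **`e(Q) ≤ e_∞` for a charged periodic configuration.** If a periodic configuration `Q` of
`ℝ³` is charged with positive density at every scale by a sequence of Lennard-Jones ground
states (for all `R, ε > 0` there is `ρ > 0` with, for infinitely many `N`, at least `ρN`
particles whose `R`-neighbourhood is `ε`-matched both ways with a rigid image of `Q`), and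
`E(N)/N → e`, then `e(Q) ≤ e` (excision of matched blocks; see the module docstring).
[folklore] -/
theorem energyPerParticle_le_of_charged (Q : PeriodicConfiguration 3)
    (x : (N : ℕ) → (Fin N → E3)) (hx : ∀ N, IsGroundState lennardJones (x N))
    (hch : ∀ R ε : ℝ, 0 < R → 0 < ε → ∃ ρ : ℝ, 0 < ρ ∧ ∃ᶠ N : ℕ in atTop,
      ρ * (N : ℝ) ≤ (Nat.card {i : Fin N // ∃ A : E3 →ₗᵢ[ℝ] E3, ∃ q ∈ Q.points,
        (∀ s ∈ Q.points, dist s q ≤ R → ∃ j : Fin N, dist (x N j) (x N i + A (s - q)) ≤ ε) ∧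
        (∀ j : Fin N, dist (x N j) (x N i) ≤ R →
          ∃ s ∈ Q.points, dist (x N j) (x N i + A (s - q)) ≤ ε)} : ℝ))
    {e : ℝ} (htend : Tendsto (fun N : ℕ => groundStateEnergy lennardJones 3 N / N) atTop (𝓝 e)) :
    Q.energyPerParticle lennardJones ≤ e := by
  classical
  -- constants of the problem
  obtain ⟨δL, hδL, hsepL⟩ := LennardJonesMinimalDistance_holds
  obtain ⟨δQ, hδQ, hsepQ⟩ := Q.exists_pos_le_dist
  have hF : (0 : ℝ) < Q.motif.card := by exact_mod_cast Q.motif_nonempty.card_pos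
  refine le_of_forall_pos_le_add fun η hη => ?_
  -- STEP 1: the block size `K` (small sixth-power tails) and the patch size `n`
  have hcQ0 : (0 : ℝ) < 1 / 12 * δQ⁻¹ ^ 6 + 64 / 3 := by positivity
  have htpos : 0 < η / 8 / (1 / 12 * δQ⁻¹ ^ 6 + 64 / 3) := by positivity
  obtain ⟨K, hK0, hK⟩ := exists_sum_tailSix_le Q htpos
  have hncard : ((Fintype.card (BIdx Q K) : ℕ) : ℝ) = Q.motif.card * (K : ℝ) ^ 3 := by
    rw [card_BIdx]; push_cast; ring
  have hnpos : 0 < Fintype.card (BIdx Q K) := by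
    rw [card_BIdx]; exact Nat.mul_pos Q.motif_nonempty.card_pos (pow_pos hK0 3)
  have hnr : (0 : ℝ) < Fintype.card (BIdx Q K) := by exact_mod_cast hnpos
  have htails : ∑ u : BIdx Q K, tailSix Q K u ≤
      η / 8 / (1 / 12 * δQ⁻¹ ^ 6 + 64 / 3) * (2 * Fintype.card (BIdx Q K)) := by
    have := hK K le_rfl
    rw [hncard]
    linarith
  have hblock := two_mul_energy_block_ge Q K hδQ hsepQ
  have hK3 : (K : ℝ) ^ 3 * (2 * Q.motif.card * Q.energyPerParticle lennardJones) =
      2 * Fintype.card (BIdx Q K) * Q.energyPerParticle lennardJones := by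
    rw [hncard]; ring
  rw [hK3] at hblock
  -- STEP 2: block radius, energy modulus, tolerance `ε`, margin `T`, radius `R`
  obtain ⟨R₀, hR₀0, hR₀⟩ := exists_block_radius Q K
  obtain ⟨ε₀, hε₀, hmod⟩ := exists_energy_modulus_block Q K
    (show 0 < η / 8 * Fintype.card (BIdx Q K) by positivity)
  obtain ⟨ε, hεpos, hεε₀, hεQ, hεL⟩ : ∃ ε : ℝ, 0 < ε ∧ ε ≤ ε₀ ∧ 4 * ε ≤ δQ ∧ 2 * ε < δL := by
    refine ⟨min ε₀ (min (δQ / 4) (δL / 4)), lt_min hε₀ (lt_min (by positivity) (by positivity)),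
      min_le_left _ _, ?_, ?_⟩
    · have : min ε₀ (min (δQ / 4) (δL / 4)) ≤ δQ / 4 := (min_le_right _ _).trans (min_le_left _ _)
      linarith
    · have : min ε₀ (min (δQ / 4) (δL / 4)) ≤ δL / 4 := (min_le_right _ _).trans (min_le_right _ _)
      linarith
  obtain ⟨T, hTpos, hfarT⟩ : ∃ T : ℝ, 0 < T ∧ 1 / 6 * (250 * δL⁻¹ ^ 5 * T⁻¹) ≤ η / 8 := by
    refine ⟨2000 * δL⁻¹ ^ 5 / η + 1, by positivity, ?_⟩
    have h2 : 0 < 2000 * δL⁻¹ ^ 5 / η := by positivity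
    have h3 : (2000 * δL⁻¹ ^ 5 / η + 1)⁻¹ ≤ (2000 * δL⁻¹ ^ 5 / η)⁻¹ := inv_anti₀ h2 (by linarith)
    rw [inv_div] at h3
    have h4 : 0 ≤ δL⁻¹ ^ 5 := by positivity
    calc 1 / 6 * (250 * δL⁻¹ ^ 5 * (2000 * δL⁻¹ ^ 5 / η + 1)⁻¹)
        ≤ 1 / 6 * (250 * δL⁻¹ ^ 5 * (η / (2000 * δL⁻¹ ^ 5))) := by gcongr
      _ = η / 48 := by field_simp; ring
      _ ≤ η / 8 := by linarith
  have hRpos : 0 < R₀ + ε + T := by positivity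
  -- STEP 3: the charging density `ρ`, the packing constant, the proportion `c`
  obtain ⟨ρ, hρ, hfreq⟩ := hch (R₀ + ε + T) ε hRpos hεpos
  have hCp : 0 < (2 * (2 * (R₀ + ε + T)) / δL + 1) ^ 3 := by positivity
  obtain ⟨c, hcpos, hcρ, hcn⟩ : ∃ c : ℝ, 0 < c ∧ c ≤ ρ / (2 * (2 * (R₀ + ε + T)) / δL + 1) ^ 3 ∧
      c * (8 * Fintype.card (BIdx Q K)) ≤ 1 := by
    refine ⟨min (ρ / (2 * (2 * (R₀ + ε + T)) / δL + 1) ^ 3) (1 / (8 * Fintype.card (BIdx Q K))),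
      lt_min (by positivity) (by positivity), min_le_left _ _, ?_⟩
    rw [← le_div_iff₀ (by positivity)]
    exact min_le_right _ _
  -- STEP 4: the thermodynamic tolerance `η₃` and the threshold `M₀`
  have hη₃ : 0 < η / 8 * c * Fintype.card (BIdx Q K) := by positivity
  obtain ⟨M₀, hM₀⟩ := Metric.tendsto_atTop.1 htend _ hη₃
  -- STEP 5: a large `N` with many good particles
  have hev : ∀ᶠ N : ℕ in atTop, 2 ≤ c * N ∧ (M₀ : ℝ) + 1 ≤ N / 2 := by
    obtain ⟨N₁, hN₁⟩ := exists_nat_ge (max (2 / c) (2 * ((M₀ : ℝ) + 1)))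
    filter_upwards [eventually_ge_atTop N₁] with N hN
    have hNr : (N₁ : ℝ) ≤ N := by exact_mod_cast hN
    have h1 : 2 / c ≤ N := ((le_max_left _ _).trans hN₁).trans hNr
    have h2 : 2 * ((M₀ : ℝ) + 1) ≤ N := ((le_max_right _ _).trans hN₁).trans hNr
    refine ⟨?_, by linarith⟩
    rwa [div_le_iff₀ hcpos, mul_comm] at h1
  obtain ⟨N, hgoodN, hcN, hNM₀⟩ := (hfreq.and_eventually hev).exists
  have hyGS : IsGroundState lennardJones (x N) := hx N
  have hsepy : ∀ k l, k ≠ l → δL ≤ dist (x N k) (x N l) := hsepL N (x N) hyGS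
  have hNpos : (0 : ℝ) < N := by nlinarith
  -- the good particles as a finset
  obtain ⟨G, hGmem, hGcard⟩ : ∃ G : Finset (Fin N), (∀ i ∈ G, ∃ A : E3 →ₗᵢ[ℝ] E3, ∃ q ∈ Q.points,
      (∀ s ∈ Q.points, dist s q ≤ R₀ + ε + T →
        ∃ j : Fin N, dist (x N j) (x N i + A (s - q)) ≤ ε) ∧
      (∀ j : Fin N, dist (x N j) (x N i) ≤ R₀ + ε + T →
        ∃ s ∈ Q.points, dist (x N j) (x N i + A (s - q)) ≤ ε)) ∧ ρ * N ≤ G.card := by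
    refine ⟨Finset.univ.filter fun i => ∃ A : E3 →ₗᵢ[ℝ] E3, ∃ q ∈ Q.points,
      (∀ s ∈ Q.points, dist s q ≤ R₀ + ε + T →
        ∃ j : Fin N, dist (x N j) (x N i + A (s - q)) ≤ ε) ∧
      (∀ j : Fin N, dist (x N j) (x N i) ≤ R₀ + ε + T →
        ∃ s ∈ Q.points, dist (x N j) (x N i + A (s - q)) ≤ ε),
      fun i hi => (Finset.mem_filter.1 hi).2, ?_⟩
    have h := hgoodN
    rwa [Nat.card_eq_fintype_card, Fintype.card_subtype] at h
  -- STEP 6: `k = ⌊cN⌋` good particles at mutual distances `> 2R`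
  obtain ⟨T', hT'G, hT'card, hk1, hsepT'⟩ :=
    exists_separated_subfamily (x N) hδL hsepy G hRpos hGcard hcρ hcN
  -- STEP 7: the excision estimate
  obtain ⟨hknN, hsurg⟩ := surgery_estimate Q K hyGS.1 hδL hsepy hδQ hsepQ hR₀ hmod hεpos hεε₀
    hεQ hεL hTpos le_rfl T' (fun t ht => hGmem t (hT'G ht)) hsepT'
  have hbudget := patch_budget (Nat.cast_nonneg T'.card) hnr.le (by positivity : (0 : ℝ) ≤ 1 / 12 * δQ⁻¹ ^ 6)
    hblock htails hsurg hfarT (by field_simp)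
  -- STEP 8: the thermodynamic comparison at `M = N` and `M = N - kn`
  have hkle : (T'.card : ℝ) ≤ c * N := by rw [hT'card]; exact Nat.floor_le (by positivity)
  have hkge : c * N - 1 ≤ T'.card := by
    rw [hT'card]
    have := Nat.lt_floor_add_one (c * (N : ℝ))
    linarith
  have hknle : (T'.card : ℝ) * Fintype.card (BIdx Q K) ≤ N / 8 := by
    have h1 : (T'.card : ℝ) * Fintype.card (BIdx Q K) ≤ c * N * Fintype.card (BIdx Q K) :=
      mul_le_mul_of_nonneg_right hkle hnr.le
    have h2 : c * N * Fintype.card (BIdx Q K) = N / 8 * (c * (8 * Fintype.card (BIdx Q K))) := by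
      ring
    have h3 : (N : ℝ) / 8 * (c * (8 * Fintype.card (BIdx Q K))) ≤ N / 8 * 1 :=
      mul_le_mul_of_nonneg_left hcn (by positivity)
    linarith
  have hM : ((N - T'.card * Fintype.card (BIdx Q K) : ℕ) : ℝ) =
      (N : ℝ) - T'.card * Fintype.card (BIdx Q K) := by
    rw [Nat.cast_sub hknN]; push_cast; ring
  have hEN : groundStateEnergy lennardJones 3 N ≤ N * (e + η / 8 * c * Fintype.card (BIdx Q K)) := by
    have h := hM₀ N (by exact_mod_cast (show (M₀ : ℝ) ≤ N by linarith))
    rw [Real.dist_eq, abs_lt] at h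
    have h2 := h.2
    rw [sub_lt_iff_lt_add, div_lt_iff₀ hNpos] at h2
    linarith
  have hEM : ((N : ℝ) - T'.card * Fintype.card (BIdx Q K)) * (e - η / 8 * c * Fintype.card (BIdx Q K)) ≤
      groundStateEnergy lennardJones 3 (N - T'.card * Fintype.card (BIdx Q K)) := by
    have hMpos : (0 : ℝ) < ((N - T'.card * Fintype.card (BIdx Q K) : ℕ) : ℝ) := by
      rw [hM]; linarith
    have hMge : M₀ ≤ N - T'.card * Fintype.card (BIdx Q K) := by
      have : (M₀ : ℝ) ≤ ((N - T'.card * Fintype.card (BIdx Q K) : ℕ) : ℝ) := by rw [hM]; linarith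
      exact_mod_cast this
    have h := hM₀ _ hMge
    rw [Real.dist_eq, abs_lt] at h
    have h1 := h.1
    rw [lt_sub_iff_add_lt, lt_div_iff₀ hMpos, hM] at h1
    linarith
  have hkn0 : (0 : ℝ) < T'.card * Fintype.card (BIdx Q K) := by
    have : (1 : ℝ) ≤ T'.card := by exact_mod_cast hk1
    positivity
  have hb : 2 * (η / 8 * c * Fintype.card (BIdx Q K)) * N ≤
      η / 2 * (T'.card * Fintype.card (BIdx Q K)) := by
    have h1 : c * N ≤ 2 * T'.card := by linarith
    have h2 := mul_le_mul_of_nonneg_left h1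
      (by positivity : (0 : ℝ) ≤ η / 4 * Fintype.card (BIdx Q K))
    linarith
  rw [hyGS.2] at hbudget
  have := thermo_bookkeeping hkn0 hη₃.le hEN hEM hbudget hb
  linarith

end Summit.AtomisticToContinuum.Crystallization.Theorems.ChargedPeriodicOptimal

namespace Summit.AtomisticToContinuum.Crystallization.Theorems

open Literature.MathematicalPhysics.StatisticalMechanics
open Summit.AtomisticToContinuum.Crystallization.Theorems.ChargedEnergyGapNegative
open Summit.AtomisticToContinuum.Crystallization.Theorems.ChargedPeriodicOptimal

/-- **Item stmt-AtomisticToContinuum-2913 `ChargedPeriodicIsOptimal`** (route `PricedLinkCensus`;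
shared with seven other `Crystallization` routes): a periodic configuration charged with
positive density at every scale by some sequence of Lennard-Jones ground states has the least
energy per particle among periodic configurations of `ℝ³` — `e(Q) ≤ lim E(N)/N = ⨅ e`
(`energyPerParticle_le_of_charged` with `crysEnergyLimit`) and `⨅ e ≤ e(Q')` (`eStar_le`).
[folklore] -/
theorem chargedPeriodicIsOptimal_proof :
    Summit.AtomisticToContinuum.Crystallization.Theses.PricedLinkCensus.ChargedPeriodicIsOptimal := by
  intro Q hQ
  obtain ⟨x, hx, hch⟩ := hQ
  refine ⟨⟨Q, rfl⟩, ?_⟩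
  rintro _ ⟨Q', rfl⟩
  have h1 : Q.energyPerParticle lennardJones ≤ eStar :=
    energyPerParticle_le_of_charged Q x hx hch crysEnergyLimit
  exact h1.trans (eStar_le Q')

end Summit.AtomisticToContinuum.Crystallization.Theorems

end
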